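import Literature.AlgebraicGeometry.HodgeTheory.ComplexConjugation
import Literature.AlgebraicGeometry.HodgeTheory.HodgeModelExistenceProofs
import HarnessLib

/-!
# Real Hodge models of smooth projective complex varieties (proof file: assembly)

Family `hodge`, layer `Literature/AlgebraicGeometry/HodgeTheory`. Companion to `ComplexConjugation`
(the named fact `exists_isReal_hodgeModel`: a smooth projective `X/ℂ` has a Hodge model whose
de Rham comparison intertwines the two complex conjugations) and to `HodgeModelExistenceProofs`
(the assembly `nonempty_hodgeModel_of` of the weaker fact `nonempty_hodgeModel n X`).

This file does for `exists_isReal_hodgeModel` what `HodgeModelExistenceProofs` does for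
`nonempty_hodgeModel`: it isolates the ONE printed ingredient that the structure `HodgeModel` does
not record — the reality of de Rham's comparison — as a named fact in the tree's currency of
isomorphism families (`Literature.NumberTheory.Transcendental.ComplexDeRhamIsoFamily`), and
PROVES the assembly (`exists_isReal_hodgeModel_of`): the fact `exists_isReal_hodgeModel` follows
from exactly three named facts of the tree,

* (3ℝ) de Rham's theorem with complex coefficients in its REAL form — a natural isomorphism
  family `H^k_dR(M; ℂ) ≃ Hᵏ(M; ℂ)` over the manifolds charted on `ℂⁿ` that commutes with complex
  conjugation (`exists_isReal_complexDeRhamIsoFamily (Fin n → ℂ)`, this file; Voisin I, §4.3.2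
  Thm. 4.47 with Rem. 4.48, and Cor. 6.12: "complex conjugation acts naturally on
  `H^{p+q}(X, ℂ) = H^{p+q}(X, ℝ) ⊗ ℂ`");
* (4a) analytifications of the smooth projective `X` are Kähler (`Literature.AlgebraicGeometry.
  Motives.isKaehlerManifold_of_isAnalytification_of_isClosedImmersion`, Voisin I §3.3.2);
* (4b) the Hodge decomposition of a compact Kähler manifold
  (`Literature.AlgebraicGeometry.Motives.isInternal_hodgePQ`, Voisin I §6.1.3 Prop. 6.11),

everything else — the analytification `X^an → X(ℂ)`, a compact Hausdorff complex manifold with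
holomorphic atlas on `ℂⁿ` (Serre, GAGA §2 n°5 Prop. 2, n°7 Prop. 6) — being PROVED in the tree
(`exists_compact_isAnalytification_of_isSmoothProjective`, `HodgeModelExistenceProofs`).

## Why a new named fact and not `exists_complexDeRhamIsoFamily`

The tree's `exists_complexDeRhamIsoFamily E` (`Transcendental/DeRhamTheorem`) asserts a NATURAL
family only. Reality is not a consequence of naturality: if `e` is natural and real then `i • e`
is natural and not real, and no natural operation recovers a real isomorphism family from an
arbitrary natural one (the conjugation-average `(e + conj ∘ e ∘ conj)/2` of `i • e₀`, `e₀` real,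
is `0`). What the sources print is stronger and is what (3ℝ) states: the comparison with complex
coefficients is the complexification of the real comparison `H^k_dR(M; ℝ) ≅ Hᵏ(M; ℝ)` — given on
differentiable singular simplices by `ω ↦ (φ ↦ ∫_Δ φ^* ω)` (Voisin I, Rem. 4.48), a formula with
`\overline{∫_φ ω} = ∫_φ ω̄` — "where complex conjugation acts naturally on
`H^k(X, ℂ) = H^k(X, ℝ) ⊗ ℂ`" (Voisin I, Cor. 6.12). In the tree's carriers the two conjugations are
`complexDeRhamCohomology.conj` (conjugation of forms, `Motives/HodgeDecomposition`, its inputs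
discharged in `Transcendental/ComplexFormsProofs`) and `conjClass` (conjugation of the values of
singular cochains, `ComplexConjugation`), and (3ℝ) says the family intertwines them on every
manifold (`ComplexDeRhamIsoFamily.IsReal`).

## Main statements

* `Literature.NumberTheory.Transcendental.ComplexDeRhamIsoFamily.IsReal e` (definition; deliberate
  dot-notation extension of the structure-like `ComplexDeRhamIsoFamily` of
  `Transcendental/DeRhamTheorem`, declared with its absolute name).
* `exists_isReal_complexDeRhamIsoFamily E` (named fact, D-0014): (3ℝ).
* `HodgeModel.isReal_mk` (proved): a Hodge model assembled from a real family is real.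
* `HodgeModel.exists_isReal_of_isAnalytification` (proved): real Hodge models from a compact
  analytification, a natural real family and the Hodge decomposition.
* `exists_isReal_hodgeModel_of_isSmoothProjective`, `exists_isReal_hodgeModel_of` (proved): the
  assembly of `exists_isReal_hodgeModel` from (3ℝ), (4a), (4b).

Discharging (3ℝ), (4a), (4b) is three separate programmes (de Rham's theorem: Poincaré lemma,
Mayer–Vietoris on both sides, small simplices; the Hodge theorem: elliptic theory on compact
manifolds; Fubini–Study and functoriality of the analytification); with them,
`exists_isReal_hodgeModel_holds := exists_isReal_hodgeModel_of ‹3ℝ› ‹4a› ‹4b›` needs no further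
work.

## References

* C. Voisin, *Hodge Theory and Complex Algebraic Geometry I* (2002), §4.3.2 (Cor. 4.37, Thm. 4.47,
  Rem. 4.48), §6.1.3 (Prop. 6.11, Cor. 6.12). (Held: `book:voisin2002-…-i`, PDF pp. 97–99, 121.)
* J.-P. Serre, *Géométrie algébrique et géométrie analytique*, Ann. Inst. Fourier 6 (1956), §2
  n°5 Prop. 2, n°7 Prop. 6. (Held: `paper:doi-10-5802-aif-59`, PDF pp. 9–10, 13.)
* R. O. Wells, *Differential Analysis on Complex Manifolds* (1980), Thm. III.4.13.
* G. de Rham (1931).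
-/

noncomputable section

open scoped Manifold ContDiff

universe u

/-! ### Real complex de Rham isomorphism families -/

namespace Literature.NumberTheory.Transcendental

namespace ComplexDeRhamIsoFamily

variable {E : Type u} [NormedAddCommGroup E] [NormedSpace ℂ E]

/-- A complex de Rham isomorphism family `e` over the manifolds charted on `E` is **real** if on
every manifold `M` it intertwines the two complex conjugations: conjugation of forms on
`H^k_dR(M; ℂ)` (`complexDeRhamCohomology.conj`, with its inputs
`conj_mem_cclosedSmoothForms_holds`, `conj_mem_cexactSmoothForms_holds`) and conjugation of the
values of cochains on `Hᵏ(M; ℂ)` (`Literature.AlgebraicGeometry.HodgeTheory.conjClass`):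
`conj (e_M a) = e_M (conj a)`. Equivalently, `e_M` is the complexification of an isomorphism
`H^k_dR(M; ℝ) ≅ Hᵏ(M; ℝ)` of the real forms ("complex conjugation acts naturally on
`H^k(X, ℂ) = H^k(X, ℝ) ⊗ ℂ`", Voisin I, Cor. 6.12). Deliberate dot-notation extension of
`ComplexDeRhamIsoFamily` (`Transcendental/DeRhamTheorem`) from the directory
`AlgebraicGeometry/HodgeTheory`, where `conjClass` lives.
[cite: VoisinHodgeI2002, §6.1.3 Cor. 6.12] -/
def IsReal (e : ComplexDeRhamIsoFamily E) : Prop :=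
  ∀ (M : Type u) [TopologicalSpace M] [ChartedSpace E M] [IsManifold 𝓘(ℝ, E) ∞ M] [T2Space M]
    [SigmaCompactSpace M] (k : ℕ) (a : complexDeRhamCohomology E M k),
    Literature.AlgebraicGeometry.HodgeTheory.conjClass M k (e M k a) =
      e M k (complexDeRhamCohomology.conj E M k conj_mem_cclosedSmoothForms_holds
        conj_mem_cexactSmoothForms_holds a)

/-- Unfolding of `IsReal` at one manifold, degree and class. [folklore] -/
theorem IsReal.conjClass_apply {e : ComplexDeRhamIsoFamily E} (he : e.IsReal) (M : Type u)
    [TopologicalSpace M] [ChartedSpace E M] [IsManifold 𝓘(ℝ, E) ∞ M] [T2Space M]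
    [SigmaCompactSpace M] (k : ℕ) (a : complexDeRhamCohomology E M k) :
    Literature.AlgebraicGeometry.HodgeTheory.conjClass M k (e M k a) =
      e M k (complexDeRhamCohomology.conj E M k conj_mem_cclosedSmoothForms_holds
        conj_mem_cexactSmoothForms_holds a) :=
  he M k a

/-- For a real family, `e_M⁻¹` intertwines the conjugations as well:
`conj (e_M⁻¹ c) = e_M⁻¹ (conj c)`. [cite: VoisinHodgeI2002, §6.1.3 Cor. 6.12] -/
theorem IsReal.conj_symm_apply {e : ComplexDeRhamIsoFamily E} (he : e.IsReal) (M : Type u)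
    [TopologicalSpace M] [ChartedSpace E M] [IsManifold 𝓘(ℝ, E) ∞ M] [T2Space M]
    [SigmaCompactSpace M] (k : ℕ)
    (c : Literature.AlgebraicTopology.SingularHomology.singularCohomology ℂ ℂ M k) :
    complexDeRhamCohomology.conj E M k conj_mem_cclosedSmoothForms_holds
        conj_mem_cexactSmoothForms_holds ((e M k).symm c) =
      (e M k).symm (Literature.AlgebraicGeometry.HodgeTheory.conjClass M k c) := by
  apply (e M k).injective
  rw [← he M k, LinearEquiv.apply_symm_apply, LinearEquiv.apply_symm_apply]

end ComplexDeRhamIsoFamily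

end Literature.NumberTheory.Transcendental

namespace Literature.AlgebraicGeometry.HodgeTheory

section HodgeTheory

open Literature.NumberTheory.Transcendental (ComplexDeRhamIsoFamily complexDeRhamCohomology
  IsAnalytification)

/-- **de Rham's theorem with complex coefficients, real form** (named fact, D-0014). For a
finite-dimensional complex normed space `E` (the binder `[FiniteDimensional ℂ E]` is part of the
fact) there is a family of `ℂ`-linear isomorphisms `H^k_dR(M; ℂ) ≃ₗ[ℂ] Hᵏ(M; ℂ)` over all real
`C^∞`, Hausdorff, σ-compact manifolds `M` charted on `E` which is NATURAL for `C^∞` maps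
(`ComplexDeRhamIsoFamily.IsNatural`) and REAL (`ComplexDeRhamIsoFamily.IsReal`: it commutes with
complex conjugation on both sides). This is de Rham's theorem `H^q_DR(X) ≅ H^q(X, ℝ) ≅
H^q_sing(X, ℝ)` (Voisin I, Cor. 4.37 and Thm. 4.47; the composite is induced by integration of
forms over differentiable singular simplices, `ω ↦ (φ ↦ ∫_Δ φ^* ω)`, Rem. 4.48) tensored with `ℂ`:
`H^k_dR(M; ℂ) = H^k_dR(M; ℝ) ⊗ ℂ` (`d` is `ℂ`-linear on `ℂ`-valued forms) and
`Hᵏ(M; ℂ) = Hᵏ(M; ℝ) ⊗ ℂ` (universal coefficients), "where complex conjugation acts naturally on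
`H^k(X, ℂ) = H^k(X, ℝ) ⊗ ℂ`" (Voisin I, Cor. 6.12). It strengthens the tree's
`Literature.NumberTheory.Transcendental.exists_complexDeRhamIsoFamily E` (naturality only) by the
reality clause, which naturality does not imply (`i • e` is natural with `e`). Consumers take
`(h : exists_isReal_complexDeRhamIsoFamily E)` (the tree's cite for the complex de Rham theorem
itself is Wells (1980), Thm. III.4.13, carried by `exists_complexDeRhamIsoFamily`).
[cite: VoisinHodgeI2002, §4.3.2 Thm. 4.47, Rem. 4.48 and §6.1.3 Cor. 6.12] -/
def exists_isReal_complexDeRhamIsoFamily (E : Type u) [NormedAddCommGroup E] [NormedSpace ℂ E]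
    [FiniteDimensional ℂ E] : Prop :=
  ∃ e : ComplexDeRhamIsoFamily E, e.IsNatural ∧ e.IsReal

/-- The real form implies the tree's complex de Rham theorem `exists_complexDeRhamIsoFamily E`
(forget reality). [cite: VoisinHodgeI2002, §4.3.2 Thm. 4.47] -/
theorem exists_isReal_complexDeRhamIsoFamily.exists_complexDeRhamIsoFamily {E : Type u}
    [NormedAddCommGroup E] [NormedSpace ℂ E] [FiniteDimensional ℂ E]
    (h : exists_isReal_complexDeRhamIsoFamily E) :
    Literature.NumberTheory.Transcendental.exists_complexDeRhamIsoFamily E :=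
  let ⟨e, he, _⟩ := h; ⟨e, he⟩

variable {n : ℕ} {X : Motives.SchemeOver ℂ}

namespace HodgeModel

/-- **A Hodge model assembled from a real family is real**: if the de Rham comparison of a Hodge
model built field by field is a real family `e`, the model is real (`HodgeModel.IsReal` is
`e.IsReal` at the carrier). [cite: VoisinHodgeI2002, §6.1.3 Cor. 6.12] -/
theorem isReal_mk (E : Type) [NormedAddCommGroup E] [NormedSpace ℂ E] [FiniteDimensional ℂ E]
    (M : Type) [TopologicalSpace M] [ChartedSpace E M] [IsManifold 𝓘(ℂ, E) ω M]
    [IsManifold 𝓘(ℝ, E) ∞ M] [T2Space M] [SigmaCompactSpace M] (φ : M → Motives.ComplexPoints X)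
    (hφ : IsAnalytification E X n φ) (e : ComplexDeRhamIsoFamily E) (he : e.IsNatural)
    (hH : ∀ k : ℕ, DirectSum.IsInternal fun pq : ↥(Finset.antidiagonal k) ↦
      Literature.NumberTheory.Transcendental.hodgePQ E M k pq.1.1 pq.1.2)
    (hr : e.IsReal) :
    HodgeModel.IsReal
      ({ model := E, carrier := M, toComplexPoints := φ, isAnalytification := hφ, deRham := e,
         deRham_isNatural := he, isInternal_hodgePQ := hH } : HodgeModel n X) :=
  fun k a ↦ hr M k a

variable (n X) in
/-- **Real Hodge models from analytifications.** A compact Hausdorff complex manifold `M` with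
holomorphic atlas on the finite-dimensional model `E`, exhibited by `φ : M → X(ℂ)` as the
analytification of `X` (relative dimension `n`), a natural AND REAL complex de Rham isomorphism
family on the manifolds charted on `E`, and the Hodge decomposition
`H^k_dR(M; ℂ) = ⨁_{p+q=k} K^{p,q}` of `M` give a REAL Hodge model of `X` (real `C^∞` structure
underlying the holomorphic atlas,
`Literature.Geometry.Kaehler.isManifold_real_of_isManifold_complex`; σ-compact because compact,
Serre, GAGA §2 n°5). The real-structure refinement of
`HodgeModel.nonempty_of_isAnalytification`. [cite: SerreGAGA1956, §2 n°5 Prop. 2]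
[cite: VoisinHodgeI2002, §6.1.3 Prop. 6.11 and Cor. 6.12] -/
theorem exists_isReal_of_isAnalytification (E : Type) [NormedAddCommGroup E] [NormedSpace ℂ E]
    [FiniteDimensional ℂ E] (M : Type) [TopologicalSpace M] [ChartedSpace E M]
    [IsManifold 𝓘(ℂ, E) ω M] [T2Space M] [CompactSpace M] (φ : M → Motives.ComplexPoints X)
    (hφ : IsAnalytification E X n φ) (e : ComplexDeRhamIsoFamily E) (he : e.IsNatural)
    (hr : e.IsReal)
    (hH : ∀ [IsManifold 𝓘(ℝ, E) ∞ M] (k : ℕ), DirectSum.IsInternal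
      fun pq : ↥(Finset.antidiagonal k) ↦
        Literature.NumberTheory.Transcendental.hodgePQ E M k pq.1.1 pq.1.2) :
    ∃ A : HodgeModel n X, A.IsReal :=
  haveI := Literature.Geometry.Kaehler.isManifold_real_of_isManifold_complex (E := E) (M := M)
  ⟨_, isReal_mk E M φ hφ e he hH hr⟩

end HodgeModel

/-- **Real Hodge models of a smooth projective complex variety, from the three named facts**
(pointwise form of `exists_isReal_hodgeModel_of`). If (3ℝ) de Rham's theorem with complex
coefficients holds in its real form over the manifolds charted on `ℂⁿ`
(`exists_isReal_complexDeRhamIsoFamily (Fin n → ℂ)`), (4a) analytifications of `X` are Kähler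
(`isKaehlerManifold_of_isAnalytification_of_isClosedImmersion`, Voisin I §3.3.2) and (4b) compact
Kähler manifolds have the Hodge decomposition (`isInternal_hodgePQ`, Voisin I §6.1.3
Prop. 6.11), then a smooth projective `X/ℂ` of dimension `n` has a real Hodge model: Serre's
analytification `X^an → X(ℂ)` (GAGA §2 n°5 Prop. 2; compact by n°7 Prop. 6), proved in the tree
(`exists_compact_isAnalytification_of_isSmoothProjective`), Kähler by (4a) along a projective
embedding `X ↪ ℙᴺ_ℂ` (`IsSmoothProjective.isProjectiveOver`), with the family (3ℝ) and the
decomposition (4b). [cite: SerreGAGA1956, §2 n°5 Prop. 2 and n°7 Prop. 6]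
[cite: VoisinHodgeI2002, §4.3.2 Rem. 4.48, §6.1.3 Prop. 6.11 and Cor. 6.12] -/
theorem exists_isReal_hodgeModel_of_isSmoothProjective
    (h3 : exists_isReal_complexDeRhamIsoFamily (Fin n → ℂ))
    (h4a : ∀ (E : Type) [NormedAddCommGroup E] [NormedSpace ℂ E] [FiniteDimensional ℂ E]
      (M : Type) [TopologicalSpace M] [ChartedSpace E M] (φ : M → Motives.ComplexPoints X),
      Motives.isKaehlerManifold_of_isAnalytification_of_isClosedImmersion
        (X := X) (d := n) (E := E) (M := M) (φ := φ))
    (h4b : ∀ (E : Type) [NormedAddCommGroup E] [NormedSpace ℂ E] [FiniteDimensional ℂ E]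
      (M : Type) [TopologicalSpace M] [ChartedSpace E M] [IsManifold 𝓘(ℝ, E) ∞ M],
      Motives.isInternal_hodgePQ (E := E) (M := M))
    (hX : Motives.IsSmoothProjective n X) :
    ∃ A : HodgeModel n X, A.IsReal := by
  obtain ⟨M, _, _, _, _, _, φ, hφ⟩ := exists_compact_isAnalytification_of_isSmoothProjective hX
  haveI : AlgebraicGeometry.SmoothOfRelativeDimension n X.hom := hX.smoothOfRelativeDimension
  haveI :=
    Literature.Geometry.Kaehler.isManifold_real_of_isManifold_complex (E := Fin n → ℂ) (M := M)
  obtain ⟨N, ι, hι⟩ := hX.isProjectiveOver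
  haveI : Literature.Geometry.Kaehler.IsKaehlerManifold (Fin n → ℂ) M := h4a (Fin n → ℂ) M φ ι hφ
  obtain ⟨e, he, hr⟩ := h3
  exact HodgeModel.exists_isReal_of_isAnalytification n X (Fin n → ℂ) M φ hφ e he hr fun k ↦
    h4b (Fin n → ℂ) M k

/-- **Reduction of the named fact `exists_isReal_hodgeModel` to three named facts of the tree.**
If (3ℝ) de Rham's theorem with complex coefficients holds in its real form over the manifolds
charted on `ℂⁿ`, every `n` (`exists_isReal_complexDeRhamIsoFamily (Fin n → ℂ)`; Voisin I
Thm. 4.47, Rem. 4.48, Cor. 6.12), (4a) analytifications of smooth projective varieties are Kähler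
(`isKaehlerManifold_of_isAnalytification_of_isClosedImmersion`; Voisin I §3.3.2) and (4b) compact
Kähler manifolds have the Hodge decomposition (`isInternal_hodgePQ`; Voisin I §6.1.3 Prop. 6.11),
then `exists_isReal_hodgeModel` holds: every smooth projective complex variety has a REAL Hodge
model. Hypotheses (4a), (4b) are quantified over all varieties and all manifolds (universe `0`)
because the fact is, and because the carrier is produced by an existential; they are fed verbatim
by the facts' future `_holds` theorems, after which
`exists_isReal_hodgeModel_holds := exists_isReal_hodgeModel_of ‹3ℝ› ‹4a› ‹4b›`.
[cite: SerreGAGA1956, §2 n°5 Prop. 2 and n°7 Prop. 6]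
[cite: VoisinHodgeI2002, §4.3.2 Rem. 4.48, §6.1.3 Prop. 6.11 and Cor. 6.12] -/
theorem exists_isReal_hodgeModel_of
    (h3 : ∀ n : ℕ, exists_isReal_complexDeRhamIsoFamily (Fin n → ℂ))
    (h4a : ∀ (n : ℕ) (X : Motives.SchemeOver ℂ) (E : Type) [NormedAddCommGroup E]
      [NormedSpace ℂ E] [FiniteDimensional ℂ E] (M : Type) [TopologicalSpace M] [ChartedSpace E M]
      (φ : M → Motives.ComplexPoints X),
      Motives.isKaehlerManifold_of_isAnalytification_of_isClosedImmersion
        (X := X) (d := n) (E := E) (M := M) (φ := φ))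
    (h4b : ∀ (E : Type) [NormedAddCommGroup E] [NormedSpace ℂ E] [FiniteDimensional ℂ E]
      (M : Type) [TopologicalSpace M] [ChartedSpace E M] [IsManifold 𝓘(ℝ, E) ∞ M],
      Motives.isInternal_hodgePQ (E := E) (M := M)) :
    exists_isReal_hodgeModel :=
  fun n X hX ↦ exists_isReal_hodgeModel_of_isSmoothProjective (h3 n) (h4a n X) h4b hX

/-- Under the same three facts, the weaker named fact `nonempty_hodgeModel n X` of
`HodgeModelExistence` follows as well (through `exists_isReal_hodgeModel.nonempty_hodgeModel`);
consistent with `nonempty_hodgeModel_of`, whose hypothesis (3) is implied by (3ℝ)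
(`exists_isReal_complexDeRhamIsoFamily.exists_complexDeRhamIsoFamily`).
[cite: SerreGAGA1956, §2 n°5 Prop. 2] -/
theorem nonempty_hodgeModel_of_isReal
    (h3 : ∀ n : ℕ, exists_isReal_complexDeRhamIsoFamily (Fin n → ℂ))
    (h4a : ∀ (n : ℕ) (X : Motives.SchemeOver ℂ) (E : Type) [NormedAddCommGroup E]
      [NormedSpace ℂ E] [FiniteDimensional ℂ E] (M : Type) [TopologicalSpace M] [ChartedSpace E M]
      (φ : M → Motives.ComplexPoints X),
      Motives.isKaehlerManifold_of_isAnalytification_of_isClosedImmersion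
        (X := X) (d := n) (E := E) (M := M) (φ := φ))
    (h4b : ∀ (E : Type) [NormedAddCommGroup E] [NormedSpace ℂ E] [FiniteDimensional ℂ E]
      (M : Type) [TopologicalSpace M] [ChartedSpace E M] [IsManifold 𝓘(ℝ, E) ∞ M],
      Motives.isInternal_hodgePQ (E := E) (M := M)) (n : ℕ) (X : Motives.SchemeOver ℂ) :
    nonempty_hodgeModel n X :=
  (exists_isReal_hodgeModel_of h3 h4a h4b).nonempty_hodgeModel n X

end HodgeTheory

end Literature.AlgebraicGeometry.HodgeTheory

end
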